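import Literature.NumberTheory.Automorphic.UnitaryGroupHeisenbergPartFubini
import Literature.NumberTheory.Automorphic.UnitaryGroupHeisenbergPartTorusNormalForm
import Literature.NumberTheory.Automorphic.UnitaryGroupHeisenbergPartTorusPushTate
import Literature.NumberTheory.Automorphic.UnitaryGroupHeisenbergPartAssembly
import Literature.NumberTheory.Automorphic.UnitaryGroupHeisenbergFibreTorusConj
import Literature.NumberTheory.Automorphic.UnitaryGroupTailClassTorusKAverage
import Literature.NumberTheory.Automorphic.UnitaryGroupUnipotentHaarNormalisation
import HarnessLib

/-!
# The Heisenberg part of the unipotent term, CLOSED modulo the `K_U`-average of the `ξ`-sum: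
# `∫_G β ψʳ_T dν_G = A·log T + B` for `T ≫ 0`, with `A`, `B` named
(Rogawski, *Automorphic Representations of Unitary Groups in Three Variables* (1990), proof of Prop. 7.3.2, pp. 96–97: the
integral of (7.3.3) gives the terms (b)+(e) — «(i) `T m(𝐙M∖𝐌¹) Φ^M(γ, f)`», `ψ̂(0) = Φ^M(γ, f)`, and (ii); Lemma 7.1.1 (pp. 89–90);
Tate, in Cassels–Fröhlich, Ch. XV, Thm. 4.4.1.)

Topic `NumberTheory/Automorphic`; namespace `Literature.NumberTheory.Automorphic.UnitaryGroup`. THEOREMS ONLY over accepted tree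
modules (no definition, no named fact, no instance, no notation, no `sorry`). Row (E) «HEISENBERG PART» of item (L5-i) «the unipotent
term `P_{z·𝒰}`» of the T1-qs LAW 5 road of `Cruxes/H413/Lines/F0_T1InnerFormTraceIdentity.lean` (cell `pub/hodgecm-mathlib`, crux
H413): THE WIRING of the (E) chain into the binder `hE` of ★ (F) `truncatedTraceClass_central_eq_linear_of_parts`
(`UnitaryGroupUnipotentTruncatedTracePolynomial`):

  ★ (E-GN) `exists_heisPart_integral_eq_torus_kOuter` (Iwasawa exchange + `Ω_N × K_U` Fubini, `UnitaryGroupHeisenbergPartFubini`)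
  ∘ ★ (E-N) `integrableOn_and_setIntegral_heisHaar_heisBracket_eq` (the inner `Ω_N`-integral at `y = t k`)
  ∘ ★ (ET-γ) `torusIntegrand_heisPart_normalForm` (normal form of the torus integrand), fed by ★ (ET-α)
    `integral_torus_conj_heisChart_eq_mul`, ★ (ET-β) `integral_kernelBorelTailClass_torus_mul_eq'`, ★ (ET-ν)
    `mul_inv_mul_integral_eq_integral_heisChart` (with ★ `integrable_uncurry_conj_central` for its integrability input)
  ∘ ★ (ET-δ) `torusStage_eq_mul_setIntegral_tateIntegrand_of_threshold` (push `T(F)∖T(𝔸) → E^×∖𝕀_E`, inversion, finiteness from Tate)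
  ∘ ★ (E)-assembly `heisPart_integral_eq_linear_of_stages_tate` (Tate's Lemma, `log (T∕H₁) = log T − log H₁`).

HYPOTHESES-FIRST in exactly what the tree does not yet discharge here: the (E-GN) inputs `hBK` (Iwasawa decomposition — ★ at the CM
pin), `hCinv`∕`hCfin` (the centre-lattice part: `B(F)`-invariance and `β`-integrability — the (C) road), `hHint` (★ (HINT) given LAW 3),
the `K_U`-average of the `ξ`-sum `hκ`∕`hκi` (leaf (ET-κ)), and `hψ : ψ ∈ 𝒮(𝔸_E)` for Rogawski's `ψ(x) = ∫ f^K(z₁ u(x,y′)) dy′` (★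
`integral_kAverage_heisChart_mem_schwartzBruhatAdele'` modulo the archimedean smoothness clause). OUTPUT: constants `C₁ > 0` (Iwasawa ∕
Weil), `C₂ ∈ (0,∞)` (the push `m(𝐙S′∖𝐒′)`) and a threshold with, for `T` above it, `β·ψʳ_T` integrable and
`∫_G β ψʳ_T dν_G = C₁·μ_X(D_E)·C₂·(V μ_X(D_E)⁻¹ 𝔉ψ(0)) · log T + C₁·μ_X(D_E)·C₂·(B_Tate(ψ) − V μ_X(D_E)⁻¹ 𝔉ψ(0) · log H(1))` — the `hE`
of ★ (F) with its `A`, `B` NAMED [(b)+(e) of Prop. 7.3.2].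

## References

* J. D. Rogawski, *Automorphic Representations of Unitary Groups in Three Variables*, Annals of Mathematics Studies 123 (1990),
  Prop. 7.3.2 (pp. 96–97), Lemma 7.1.1 (pp. 89–90) [Rogawski1990].
* J. Tate, *Fourier analysis in number fields and Hecke's zeta-functions*, in Cassels–Fröhlich (eds.), *Algebraic Number Theory*
  (1967), Ch. XV, Thm. 4.4.1 [CasselsFrohlichANT1967].
-/

set_option autoImplicit false

noncomputable section

open MeasureTheory MeasureTheory.Measure NumberField IsDedekindDomain Set Filter Polynomial Function Literature.MeasureTheory.Group
open scoped ENNReal NNReal MatrixGroups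
open Literature.NumberTheory.Automorphic.Meyer

namespace Literature.NumberTheory.Automorphic

namespace UnitaryGroup

variable {F E : Type} [Field F] [NumberField F] [Field E] [NumberField E] [Algebra F E]
  {c : E ≃ₐ[F] E} {ι : Type*}

variable (ζ : ratOne F E c) {z₁ : (quasiSplit F E c 3).arithmeticSubgroup}
  [MeasurableSpace (quasiSplit F E c 3).Adelic] [BorelSpace (quasiSplit F E c 3).Adelic]
  [MeasurableSpace (AdeleRing (𝓞 E) E)] [BorelSpace (AdeleRing (𝓞 E) E)] [LocallyCompactSpace (AdeleRing (𝓞 E) E)]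
  [MeasurableSpace (adelicUnipotent F E c 3)] [BorelSpace (adelicUnipotent F E c 3)]
  [MeasurableSpace (GaloisRepresentations.ideleGroup E)] [BorelSpace (GaloisRepresentations.ideleGroup E)]

/-- **THE HEISENBERG PART OF THE UNIPOTENT TERM, WIRED** [Rogawski1990, proof of Prop. 7.3.2, pp. 96–97: (7.3.3) ⇒ (b)+(e)]. For a
quadratic `E∕F` (`[E:F] = 2`, `c² = 1`, `c ≠ 1`), the central class `𝔬 = z·𝒰(F)` (letters `ζ hz₁ hcl hclN` of ★ B1), `f ∈ C_c(G(𝔸_F))`,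
Haar measures `ν_G, μ_B, μ_K, μ_T, μ_X, μ_Y, ν, ν_I`, the Iwasawa decomposition `hBK`, covering weights `β` of `B(F)♯` and `w_T` of
`T(F)`, an idele class domain `𝓕_E`, GIVEN the (C)-road letters `hCinv`, `hCfin`, the (HINT) letter `hHint`, the `K_U`-average of
the `ξ`-sum `hκ`∕`hκi` and `ψ ∈ 𝒮(𝔸_E)`: there are `C₁ > 0`, `C₂ ∈ (0, ∞)` and `T₄` such that for all `T > T₄`, `β·ψʳ_T` is
`ν_G`-integrable and `∫_G β ψʳ_T dν_G = A·log T + B` with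
`A = C₁·(μ_X(D_E)·C₂)·(V·μ_X(D_E)⁻¹·𝔉ψ(0))`, `B = C₁·(μ_X(D_E)·C₂)·(B_Tate(ψ) − V·μ_X(D_E)⁻¹·𝔉ψ(0)·log H(1))` — EXACTLY the binder `hE`
of ★ (F) `truncatedTraceClass_central_eq_linear_of_parts` (`ψʳ_T` = second summand of ★ `bracket_eq_centrePart_add_heisPart` minus
the tail). [cite: Rogawski1990, Prop. 7.3.2 (pp. 96–97)] [cite: CasselsFrohlichANT1967, Ch. XV Thm. 4.4.1] -/
theorem heisPart_integral_eq_linear {cl : (quasiSplit F E c 3).arithmeticSubgroup → ι} (h2 : Module.finrank F E = 2)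
    (hc : c * c = 1) (hc1 : c ≠ 1)
    (hz₁ : (z₁ : (quasiSplit F E c 3).Adelic) =
      (quasiSplit F E c 3).toAdelic (ratCenter F E c 3 ((StdForm.antidiagonal 3).over E) ζ))
    (hclN : IsUnipotentInvariantOnBorel F E c 3 cl)
    (ν : Measure (adelicUnipotent F E c 3)) [ν.IsHaarMeasure]
    {𝓕 : Set (adelicUnipotent F E c 3)} (h𝓕 : IsFundamentalDomain (rationalUnipotent F E c 3) 𝓕 ν) {i : ι}
    (hcl : ∀ γ : (quasiSplit F E c 3).arithmeticSubgroup, cl γ = i ↔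
      ((adelicVal F E c 3 _ (γ : (quasiSplit F E c 3).Adelic) : GL (Fin 3) (AdeleRing (𝓞 E) E)) :
          Matrix (Fin 3) (Fin 3) (AdeleRing (𝓞 E) E)).charpoly =
        ((X - C ((ζ : Eˣ) : E)) ^ 3).map (algebraMap E (AdeleRing (𝓞 E) E)))
    {f : (quasiSplit F E c 3).Adelic → ℂ} (hfc : Continuous f) (hf : HasCompactSupport f)
    (νG : Measure (quasiSplit F E c 3).Adelic) [νG.IsHaarMeasure]
    (μB : Measure (borelAdelic F E c 3)) [μB.IsHaarMeasure]
    (μK : Measure ((standardMaximalCompactGL 3 E).comap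
      (adelicVal F E c 3 ((StdForm.antidiagonal 3).over E)) : Subgroup (quasiSplit F E c 3).Adelic))
    [μK.IsHaarMeasure]
    (hBK : ∀ g : (quasiSplit F E c 3).Adelic, ∃ b ∈ borelAdelic F E c 3, ∃ k : (quasiSplit F E c 3).Adelic,
      adelicVal F E c 3 ((StdForm.antidiagonal 3).over E) k ∈ standardMaximalCompactGL 3 E ∧ g = b * k)
    (μT : Measure (torusInBorel F E c 3)) [μT.IsHaarMeasure]
    (μX : Measure (AdeleRing (𝓞 E) E)) [μX.IsAddHaarMeasure]
    (μY : Measure (traceZeroAdele F E c)) [μY.IsAddHaarMeasure]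
    {wT : torusInBorel F E c 3 → ℝ≥0∞}
    (hwT : IsCoveringWeight ((((quasiSplit F E c 3).arithmeticSubgroup).subgroupOf (borelAdelic F E c 3)).subgroupOf
      (torusInBorel F E c 3)) wT)
    {β : (quasiSplit F E c 3).Adelic → ℝ≥0∞}
    (hβ : IsCoveringWeight ((arithmeticBorel F E c 3).map (quasiSplit F E c 3).arithmeticSubgroup.subtype) β)
    (hCinv : ∀ b ∈ arithmeticBorel F E c 3, ∀ y : (quasiSplit F E c 3).Adelic,
      (∑' w : {w : rationalTraceZero F E c // w ≠ 0},
        f (((b : (quasiSplit F E c 3).Adelic) * y)⁻¹ * ((z₁ : (quasiSplit F E c 3).Adelic) *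
          (((heisChart hc ((0 : AdeleRing (𝓞 E) E), ((w.1 : rationalTraceZero F E c) : traceZeroAdele F E c))) :
            adelicUnipotent F E c 3) : (quasiSplit F E c 3).Adelic)) * ((b : (quasiSplit F E c 3).Adelic) * y))) =
      ∑' w : {w : rationalTraceZero F E c // w ≠ 0},
        f (y⁻¹ * ((z₁ : (quasiSplit F E c 3).Adelic) *
          (((heisChart hc ((0 : AdeleRing (𝓞 E) E), ((w.1 : rationalTraceZero F E c) : traceZeroAdele F E c))) :
            adelicUnipotent F E c 3) : (quasiSplit F E c 3).Adelic)) * y))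
    (hCfin : ∫⁻ g, β g * ‖∑' w : {w : rationalTraceZero F E c // w ≠ 0},
        f (g⁻¹ * ((z₁ : (quasiSplit F E c 3).Adelic) *
          (((heisChart hc ((0 : AdeleRing (𝓞 E) E), ((w.1 : rationalTraceZero F E c) : traceZeroAdele F E c))) :
            adelicUnipotent F E c 3) : (quasiSplit F E c 3).Adelic)) * g)‖ₑ ∂νG < ∞)
    (hHint : ∃ T₀ : ℝ≥0, ∀ T : ℝ≥0, T₀ < T →
      ∫⁻ g, β g * ‖(∑' u : {u : rationalUnipotent F E c 3 // u ≠ 1},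
        f (g⁻¹ * ((z₁ * ⟨(((u.1 : rationalUnipotent F E c 3) : adelicUnipotent F E c 3) :
          (quasiSplit F E c 3).Adelic), (u.1 : rationalUnipotent F E c 3).2⟩ :
            (quasiSplit F E c 3).arithmeticSubgroup) : (quasiSplit F E c 3).Adelic) * g)) -
      kernelBorelTailClass ν 𝓕 T cl i f g‖ₑ ∂νG < ∞)
    (νI : Measure (GaloisRepresentations.ideleGroup E)) [νI.IsHaarMeasure]
    {𝓕E : Set (GaloisRepresentations.ideleGroup E)} (h𝓕E : IsIdeleClassDomain E 𝓕E)
    -- (ET-κ) the `K_U`-average of the `ξ`-sum, fibre by fibre (leaf; `T`-free)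
    (hκ : ∀ t : torusInBorel F E c 3,
      ∫ k, (∑' ξ : {ξ : E // ξ ≠ 0}, ∫ y' : traceZeroAdele F E c,
        f ((((t : borelAdelic F E c 3) : (quasiSplit F E c 3).Adelic) * (k : (quasiSplit F E c 3).Adelic))⁻¹ *
          ((z₁ : (quasiSplit F E c 3).Adelic) *
            (((heisChart hc (algebraMap E (AdeleRing (𝓞 E) E) (ξ : E), y')) : adelicUnipotent F E c 3) :
              (quasiSplit F E c 3).Adelic)) *
          (((t : borelAdelic F E c 3) : (quasiSplit F E c 3).Adelic) * (k : (quasiSplit F E c 3).Adelic))) ∂μY) ∂μK =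
      ∑' ξ : {ξ : E // ξ ≠ 0}, ∫ y' : traceZeroAdele F E c,
        (∫ k, f ((k : (quasiSplit F E c 3).Adelic)⁻¹ * ((z₁ : (quasiSplit F E c 3).Adelic) *
          ((((t : borelAdelic F E c 3) : (quasiSplit F E c 3).Adelic))⁻¹ *
            (((heisChart hc (algebraMap E (AdeleRing (𝓞 E) E) (ξ : E), y')) : adelicUnipotent F E c 3) :
              (quasiSplit F E c 3).Adelic) *
            ((t : borelAdelic F E c 3) : (quasiSplit F E c 3).Adelic))) * (k : (quasiSplit F E c 3).Adelic)) ∂μK) ∂μY)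
    (hκi : ∀ t : torusInBorel F E c 3, Integrable (fun k : ((standardMaximalCompactGL 3 E).comap
        (adelicVal F E c 3 ((StdForm.antidiagonal 3).over E)) : Subgroup (quasiSplit F E c 3).Adelic) =>
      ∑' ξ : {ξ : E // ξ ≠ 0}, ∫ y' : traceZeroAdele F E c,
        f ((((t : borelAdelic F E c 3) : (quasiSplit F E c 3).Adelic) * (k : (quasiSplit F E c 3).Adelic))⁻¹ *
          ((z₁ : (quasiSplit F E c 3).Adelic) *
            (((heisChart hc (algebraMap E (AdeleRing (𝓞 E) E) (ξ : E), y')) : adelicUnipotent F E c 3) :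
              (quasiSplit F E c 3).Adelic)) *
          (((t : borelAdelic F E c 3) : (quasiSplit F E c 3).Adelic) * (k : (quasiSplit F E c 3).Adelic))) ∂μY) μK)
    -- Rogawski's `ψ` is Schwartz–Bruhat
    (hψ : (fun x => ∫ y' : traceZeroAdele F E c,
        (∫ k, f ((k : (quasiSplit F E c 3).Adelic)⁻¹ * ((z₁ : (quasiSplit F E c 3).Adelic) *
          (((heisChart hc (x, y')) : adelicUnipotent F E c 3) :
              (quasiSplit F E c 3).Adelic)) * (k : (quasiSplit F E c 3).Adelic)) ∂μK) ∂μY) ∈ schwartzBruhatAdele E) :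
    ∃ C₁ : ℝ, 0 < C₁ ∧ ∃ C₂ : ℝ≥0∞, C₂ ≠ 0 ∧ C₂ ≠ ∞ ∧ ∃ T₄ : ℝ≥0, ∀ T : ℝ≥0, T₄ < T →
      Integrable (fun g : (quasiSplit F E c 3).Adelic => (β g).toReal •
        ((∑' ξ : {ξ : E // ξ ≠ 0}, ∑' w : rationalTraceZero F E c,
          f (g⁻¹ * ((z₁ : (quasiSplit F E c 3).Adelic) *
            (((heisChart hc (algebraMap E (AdeleRing (𝓞 E) E) (ξ : E), (w : traceZeroAdele F E c))) :
              adelicUnipotent F E c 3) : (quasiSplit F E c 3).Adelic)) * g)) -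
          kernelBorelTailClass ν 𝓕 T cl i f g)) νG ∧
      ∫ g, (β g).toReal •
        ((∑' ξ : {ξ : E // ξ ≠ 0}, ∑' w : rationalTraceZero F E c,
          f (g⁻¹ * ((z₁ : (quasiSplit F E c 3).Adelic) *
            (((heisChart hc (algebraMap E (AdeleRing (𝓞 E) E) (ξ : E), (w : traceZeroAdele F E c))) :
              adelicUnipotent F E c 3) : (quasiSplit F E c 3).Adelic)) * g)) -
          kernelBorelTailClass ν 𝓕 T cl i f g) ∂νG =
        (C₁ : ℂ) * ((μX.real (adeleFundamentalDomain E) : ℂ) * (C₂.toReal : ℂ)) *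
            (((idelicCovolume E νI).toReal : ℂ) * (((μX (adeleFundamentalDomain E)).toReal⁻¹ : ℂ) *
              adeleFourier E μX (fun x => ∫ y' : traceZeroAdele F E c,
        (∫ k, f ((k : (quasiSplit F E c 3).Adelic)⁻¹ * ((z₁ : (quasiSplit F E c 3).Adelic) *
          (((heisChart hc (x, y')) : adelicUnipotent F E c 3) :
              (quasiSplit F E c 3).Adelic)) * (k : (quasiSplit F E c 3).Adelic)) ∂μK) ∂μY) 0)) * ((Real.log (T : ℝ) : ℝ) : ℂ) +
          (C₁ : ℂ) * ((μX.real (adeleFundamentalDomain E) : ℂ) * (C₂.toReal : ℂ)) *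
            (((∫ x in {x | 1 ≤ (IdeleClassGroup.ideleNorm E x : ℝ)} ∩ 𝓕E,
                  ideleSum E (fun x => ∫ y' : traceZeroAdele F E c,
        (∫ k, f ((k : (quasiSplit F E c 3).Adelic)⁻¹ * ((z₁ : (quasiSplit F E c 3).Adelic) *
          (((heisChart hc (x, y')) : adelicUnipotent F E c 3) :
              (quasiSplit F E c 3).Adelic)) * (k : (quasiSplit F E c 3).Adelic)) ∂μK) ∂μY) x * ((IdeleClassGroup.ideleNorm E x : ℝ) : ℂ) ∂νI) +
                ((μX (adeleFundamentalDomain E)).toReal⁻¹ : ℂ) *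
                  (∫ x in {x | 1 ≤ (IdeleClassGroup.ideleNorm E x : ℝ)} ∩ 𝓕E,
                    ideleSum E (adeleFourier E μX (fun x => ∫ y' : traceZeroAdele F E c,
        (∫ k, f ((k : (quasiSplit F E c 3).Adelic)⁻¹ * ((z₁ : (quasiSplit F E c 3).Adelic) *
          (((heisChart hc (x, y')) : adelicUnipotent F E c 3) :
              (quasiSplit F E c 3).Adelic)) * (k : (quasiSplit F E c 3).Adelic)) ∂μK) ∂μY)) x ∂νI) -
                ((idelicCovolume E νI).toReal : ℂ) * (fun x => ∫ y' : traceZeroAdele F E c,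
        (∫ k, f ((k : (quasiSplit F E c 3).Adelic)⁻¹ * ((z₁ : (quasiSplit F E c 3).Adelic) *
          (((heisChart hc (x, y')) : adelicUnipotent F E c 3) :
              (quasiSplit F E c 3).Adelic)) * (k : (quasiSplit F E c 3).Adelic)) ∂μK) ∂μY) 0) -
              (((idelicCovolume E νI).toReal : ℂ) * (((μX (adeleFundamentalDomain E)).toReal⁻¹ : ℂ) *
                  adeleFourier E μX (fun x => ∫ y' : traceZeroAdele F E c,
        (∫ k, f ((k : (quasiSplit F E c 3).Adelic)⁻¹ * ((z₁ : (quasiSplit F E c 3).Adelic) *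
          (((heisChart hc (x, y')) : adelicUnipotent F E c 3) :
              (quasiSplit F E c 3).Adelic)) * (k : (quasiSplit F E c 3).Adelic)) ∂μK) ∂μY) 0)) *
                ((Real.log (borelHeight (1 : (quasiSplit F E c 3).Adelic) : ℝ) : ℝ) : ℂ)) := by
  -- (E-GN), `K` outside
  obtain ⟨C₁, hC₁, T₁, hGN⟩ := exists_heisPart_integral_eq_torus_kOuter ζ hc hc1 hz₁ hclN ν h𝓕 hcl hfc hf νG μB μK hBK μT μX μY
    hwT hβ hCinv hCfin hHint
  have hH₁ : (0 : ℝ) < (borelHeight (1 : (quasiSplit F E c 3).Adelic) : ℝ) := by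
    exact_mod_cast borelHeight_pos (1 : (quasiSplit F E c 3).Adelic)
  -- `N(𝔸_F)` closed: second countable, locally compact, `ν` s-finite
  haveI := t2Space_adeleRing_of_numberField E
  haveI := secondCountableTopology_adeleRing E
  haveI := locallyCompactSpace_adeleRing' E
  haveI : T2Space (quasiSplit F E c 3).Adelic :=
    inferInstanceAs (T2Space (adelic F E c 3 ((StdForm.antidiagonal 3).over E)))
  haveI : LocallyCompactSpace (quasiSplit F E c 3).Adelic :=
    inferInstanceAs (LocallyCompactSpace (adelic F E c 3 ((StdForm.antidiagonal 3).over E)))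
  haveI : SecondCountableTopology (quasiSplit F E c 3).Adelic :=
    inferInstanceAs (SecondCountableTopology (adelic F E c 3 ((StdForm.antidiagonal 3).over E)))
  have hNcl : IsClosed ((adelicUnipotent F E c 3 : Set (quasiSplit F E c 3).Adelic)) := by
    change IsClosed (⇑(adelicVal F E c 3 ((StdForm.antidiagonal 3).over E)) ⁻¹'
      ((upperUnitriangular (Fin 3) (AdeleRing (𝓞 E) E) : Subgroup (GL (Fin 3) (AdeleRing (𝓞 E) E))) :
        Set (GL (Fin 3) (AdeleRing (𝓞 E) E))))
    exact (isClosed_upperUnitriangular (R := AdeleRing (𝓞 E) E)).preimage continuous_subtype_val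
  haveI : SecondCountableTopology (adelicUnipotent F E c 3) := TopologicalSpace.Subtype.secondCountableTopology _
  haveI : LocallyCompactSpace (adelicUnipotent F E c 3) := hNcl.locallyCompactSpace
  haveI : SFinite ν := inferInstance
  haveI : CompactSpace ((standardMaximalCompactGL 3 E).comap
      (adelicVal F E c 3 ((StdForm.antidiagonal 3).over E)) : Subgroup (quasiSplit F E c 3).Adelic) :=
    isCompact_iff_compactSpace.1 isCompact_comap_adelicVal_standardMaximalCompactGL
  haveI : IsFiniteMeasure μK := CompactSpace.isFiniteMeasure
  -- integrability input of (ET-ν)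
  have hg : Integrable (fun m : adelicUnipotent F E c 3 => ∫ k, f ((k : (quasiSplit F E c 3).Adelic)⁻¹ * ((z₁ : (quasiSplit F E c 3).Adelic) *
      ((m : adelicUnipotent F E c 3) : (quasiSplit F E c 3).Adelic)) * (k : (quasiSplit F E c 3).Adelic)) ∂μK) ν :=
    (integrable_uncurry_conj_central isCompact_comap_adelicVal_standardMaximalCompactGL μK ν (z₁ : (quasiSplit F E c 3).Adelic) hfc hf).swap.integral_prod_left
  have hν' := mul_inv_mul_integral_eq_integral_heisChart hc μX μY ν h𝓕 hg
  -- the torus stage: normal form (ET-γ) pushed by (ET-δ), finiteness from Tate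
  obtain ⟨C₂, hC₂0, hC₂t, hTS⟩ := torusStage_eq_mul_setIntegral_tateIntegrand_of_threshold h2 hc hc1 μT μX νI h𝓕E hwT hψ hH₁ T₁
    (Θ := fun T t => ∫ k, (((μX.real (adeleFundamentalDomain E) : ℝ) : ℂ) *
          (∑' ξ : {ξ : E // ξ ≠ 0}, ∫ y' : traceZeroAdele F E c,
            f ((((t : borelAdelic F E c 3) : (quasiSplit F E c 3).Adelic) * (k : (quasiSplit F E c 3).Adelic))⁻¹ *
              ((z₁ : (quasiSplit F E c 3).Adelic) *
                (((heisChart hc (algebraMap E (AdeleRing (𝓞 E) E) (ξ : E), y')) : adelicUnipotent F E c 3) :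
              (quasiSplit F E c 3).Adelic)) *
              (((t : borelAdelic F E c 3) : (quasiSplit F E c 3).Adelic) * (k : (quasiSplit F E c 3).Adelic))) ∂μY) -
        (μX (adeleFundamentalDomain E) * μY (traceZeroFundamentalDomain F E c)).toReal •
          kernelBorelTailClass ν 𝓕 T cl i f (((t : borelAdelic F E c 3) : (quasiSplit F E c 3).Adelic) * (k : (quasiSplit F E c 3).Adelic))) ∂μK)
    (fun T hT t => torusIntegrand_heisPart_normalForm h2 hc hc1 ν 𝓕 i f μK μX μY (pos_of_gt hT) t (hκ t) (hκi t)
      (fun x => integral_torus_conj_heisChart_eq_mul hc μY hc1 h2 t x (fun v => ∫ k, f ((k : (quasiSplit F E c 3).Adelic)⁻¹ *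
        ((z₁ : (quasiSplit F E c 3).Adelic) * v) * (k : (quasiSplit F E c 3).Adelic)) ∂μK))
      (integral_kernelBorelTailClass_torus_mul_eq' ζ hc hc1 ν h𝓕 hclN hz₁ hcl hfc hf T μK t)
      (integrable_kernelBorelTailClass_torus_mul ζ hc hc1 ν h𝓕 hclN hz₁ hcl hfc hf T μK t)
      (by rw [Complex.ofReal_inv, ← mul_assoc]; exact hν'))
  refine ⟨C₁, hC₁, C₂, hC₂0, hC₂t, ?_⟩
  refine heisPart_integral_eq_linear_of_stages_tate E μX νI h𝓕E hψ hH₁ (C₁ := (C₁ : ℂ))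
    (J := fun T => ∫ t : torusInBorel F E c 3,
      ((wT t).toReal * ((torusRootModulus E 3 (diagUnit (t : borelAdelic F E c 3).2) : ℝ≥0) : ℝ)⁻¹) •
        ∫ k, (((μX.real (adeleFundamentalDomain E) : ℝ) : ℂ) *
          (∑' ξ : {ξ : E // ξ ≠ 0}, ∫ y' : traceZeroAdele F E c,
            f ((((t : borelAdelic F E c 3) : (quasiSplit F E c 3).Adelic) * (k : (quasiSplit F E c 3).Adelic))⁻¹ *
              ((z₁ : (quasiSplit F E c 3).Adelic) *
                (((heisChart hc (algebraMap E (AdeleRing (𝓞 E) E) (ξ : E), y')) : adelicUnipotent F E c 3) :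
              (quasiSplit F E c 3).Adelic)) *
              (((t : borelAdelic F E c 3) : (quasiSplit F E c 3).Adelic) * (k : (quasiSplit F E c 3).Adelic))) ∂μY) -
        (μX (adeleFundamentalDomain E) * μY (traceZeroFundamentalDomain F E c)).toReal •
          kernelBorelTailClass ν 𝓕 T cl i f (((t : borelAdelic F E c 3) : (quasiSplit F E c 3).Adelic) * (k : (quasiSplit F E c 3).Adelic))) ∂μK ∂μT) ?_ ?_
  · -- (E-GN) with the inner `Ω_N`-integral evaluated by ★ (E-N) FILE 2
    refine ⟨T₁, fun T hT => ?_⟩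
    obtain ⟨hI, hV⟩ := hGN T hT
    refine ⟨hI, ?_⟩
    rw [hV]
    congr 1
    refine integral_congr_ae (ae_of_all _ fun t => ?_)
    dsimp only
    congr 1
    refine integral_congr_ae (ae_of_all _ fun k => ?_)
    exact (integrableOn_and_setIntegral_heisHaar_heisBracket_eq ζ hc μX μY hc1 hz₁ ν h𝓕 hclN hcl hfc hf T (((t : borelAdelic F E c 3) : (quasiSplit F E c 3).Adelic) * (k : (quasiSplit F E c 3).Adelic))).2
  · -- (E-T)
    exact ⟨T₁, fun T hT => hTS T hT⟩

end UnitaryGroup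

end Literature.NumberTheory.Automorphic
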